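import Summits.Ventures.HodgeRepro.SingleClass

/-!
# Degree 16: a single-class `SumTwo` quadruple WITHOUT a conjugate pair exists

Blind re-derivation cell `pub-hodge-repro`, seat `p1` (gen 6).  Continues `SingleClass.lean` /
`QuadFinset12.lean` (typer).  ROUTE.md §3.4 records — kernel-checked for every `(G, c)` of degrees
6, 8, 12 (`QuadFinset12.lean`) — that no `SumTwo` quadruple of CM types without a conjugate pair is
single-class.  This is a LOW-DEGREE phenomenon: in degree 16 it fails.  On `C₄ × C₄` with the complex
conjugation `c = (0, 2)`, the primitive CM type
`Φ₁₆ = {(0,0), (0,1), (1,0), (1,1), (2,0), (2,3), (3,0), (3,3)}` and its three twists by the subgroup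
`Δ = ⟨(1, 2)⟩ = {(0,0), (1,2), (2,0), (3,2)}` (a subgroup of order `4` NOT containing `c`) form the
quadruple `T₁₆ i = Φ₁₆ · (1,2)^i` in which every embedding lies in exactly two corners (`SumTwo`) and
no two corners are complex-conjugate — single-class by construction (`IsSingleClass`).

Reading (Pohlmann's criterion, Gordon §9.2 / Milne (eq2) as printed in `route/SOURCES.md`): for a
Galois CM field `F` with group `C₄ × C₄` and `K' = F^Δ` the quartic CM subfield fixed by `Δ`,
`H¹(A_Φ)` is a `4`-dimensional `K'`-vector space whose `K'`-signature is balanced — every coset `xΔ`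
meets `Φ₁₆` in exactly two embeddings, which IS the `SumTwo` condition of the quadruple — so
`∧⁴_{K'} H¹(A_Φ) ⊂ H⁴(A_Φ)` is a space of Hodge classes of Weil type relative to `K'`, in
CODIMENSION 2 on the SIMPLE (primitive type) CM abelian `8`-fold `A_Φ`.  It is not a product of
divisor classes (no conjugate pair) and it is not a census face (pairing pattern `(2, 4, 2)`, not
`(1, 1, 6)`).  Degrees 6, 8, 12 have no such class (`QuadFinset12.lean`); degree 16 does.  Census by
`proofs/p1-g6/singleclass16.py`: 1792 pointed instances on 23 of the 46 pairs `(G, c)` of order 16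
(every group of order 16 except `C₁₆`, `C₂⁴`, `D₈`, `Q₁₆`, `C₄ ∘ D₄`), all of pattern `(4,2,2)` up to
order, all with a primitive base type, and NO single-class census face in any of them — the face
statement is generic (`NoSingleClassFace.lean`).
-/

set_option autoImplicit false

open Finset
open scoped Pointwise

namespace HodgeRepro

/-- The group `C₄ × C₄` of order `16`, written multiplicatively (as `Groups.lean` writes `C₄ × C₂`). -/
abbrev C4xC4 := Multiplicative (ZMod 4 × ZMod 4)

/-- The complex conjugation `(0, 2)` of `C₄ × C₄`. -/
def cc_C4xC4 : C4xC4 := Multiplicative.ofAdd (0, 2)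

/-- `cc_C4xC4` is a complex conjugation (`decide`). -/
theorem cc_C4xC4_isComplexConj : IsComplexConj cc_C4xC4 := by decide

/-- The generator `(1, 2)` of the order-`4` subgroup `Δ` not containing `c`. -/
def gen_C4xC4 : C4xC4 := Multiplicative.ofAdd (1, 2)

/-- The CM type `Φ₁₆ = {(0,0), (0,1), (1,0), (1,1), (2,0), (2,3), (3,0), (3,3)}` of `(C₄ × C₄, (0,2))`. -/
def Φ16 : Finset C4xC4 :=
  {Multiplicative.ofAdd (0, 0), Multiplicative.ofAdd (0, 1), Multiplicative.ofAdd (1, 0),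
   Multiplicative.ofAdd (1, 1), Multiplicative.ofAdd (2, 0), Multiplicative.ofAdd (2, 3),
   Multiplicative.ofAdd (3, 0), Multiplicative.ofAdd (3, 3)}

/-- The quadruple of twists `T₁₆ i = Φ₁₆ · (1,2)^i`, `i = 0, 1, 2, 3`: the corners are the right
translates of `Φ₁₆` by the subgroup `Δ = ⟨(1,2)⟩`. -/
def T16 (i : Fin 4) : Finset C4xC4 := rmul Φ16 (gen_C4xC4 ^ (i : ℕ))

/-- `Φ₁₆` is a CM type of `(C₄ × C₄, (0,2))`. -/
theorem Φ16_isCMType : IsCMType cc_C4xC4 Φ16 := by decide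

/-- `Φ₁₆` is primitive: no non-trivial twist fixes it (`A_{Φ₁₆}` is a SIMPLE CM abelian `8`-fold). -/
theorem Φ16_isPrimitive : IsPrimitive Φ16 := by decide

/-- Every embedding of `C₄ × C₄` lies in exactly two of the four corners `T₁₆ i`. -/
theorem sumTwo_T16 : SumTwo T16 := by
  unfold SumTwo; decide

/-- No two corners of `T₁₆` are complex-conjugate types (the class is not a product of divisor
classes). -/
theorem T16_noConjugatePair : ∀ i j : Fin 4, T16 j ≠ cc_C4xC4 • T16 i := by decide

/-- `T₁₆` is single-class: every corner is a right translate of `T₁₆ 0 = Φ₁₆`. -/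
theorem T16_isSingleClass : IsSingleClass T16 := fun i => ⟨gen_C4xC4 ^ (i : ℕ), rfl⟩

/-- The pairing pattern of `T₁₆` is `(2, 4, 2)` — not the face pattern `(1, 1, 6)` of
`FacePattern.lean`: `T₁₆` is not a census face. -/
theorem T16_pattern :
    (Φ16 ∩ T16 1).card = 2 ∧ (Φ16 ∩ T16 2).card = 4 ∧ (Φ16 ∩ T16 3).card = 2 := by decide

/-- The four corners are pairwise distinct CM types. -/
theorem T16_nodup : ∀ i j : Fin 4, T16 i = T16 j → i = j := by decide

/-- **Degree 16 has a single-class `SumTwo` quadruple without a conjugate pair** — the exact negation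
of the shape proved for degrees 6, 8, 12 in `QuadFinset12.lean`
(`IsCMType c (T 0) → SumTwo T → (∀ i j, T j ≠ c • T i) → ¬ IsSingleClass T`). -/
theorem exists_singleClass_sumTwo_C4xC4 :
    ∃ T : Fin 4 → Finset C4xC4, IsCMType cc_C4xC4 (T 0) ∧ SumTwo T ∧
      (∀ i j : Fin 4, T j ≠ cc_C4xC4 • T i) ∧ IsSingleClass T :=
  ⟨T16, Φ16_isCMType, sumTwo_T16, T16_noConjugatePair, T16_isSingleClass⟩

/-- The same with a PRIMITIVE base type: the class lives on a simple CM abelian `8`-fold. -/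
theorem exists_singleClass_sumTwo_primitive_C4xC4 :
    ∃ T : Fin 4 → Finset C4xC4, IsCMType cc_C4xC4 (T 0) ∧ IsPrimitive (T 0) ∧ SumTwo T ∧
      (∀ i j : Fin 4, T j ≠ cc_C4xC4 • T i) ∧ IsSingleClass T :=
  ⟨T16, Φ16_isCMType, Φ16_isPrimitive, sumTwo_T16, T16_noConjugatePair, T16_isSingleClass⟩

end HodgeRepro
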